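import Summits.RiemannHypothesis.RiemannHypothesis.Theorems.PfPersistenceHeightLocality
import Summits.RiemannHypothesis.RiemannHypothesis.Theorems.PfPersistenceGalerkinFormDomain
import HarnessLib

/-!
# PF persistence — the IN-WINDOW ONE-DIAL MIRROR and the `τ_unif`-continuity of `ε₁` (pub-rhpf, barrier-typer gen 4)

**HONEST FRAMING. This is a long-odds MECHANISM SEARCH; no RH claims.** Everything below is RH-free linear
algebra about the cell's observatory records (`Datum` = even blocks of truncated Weil forms at every window);
nothing here bears on the truth of RH.

RULING A73 (F) (adj-3 gen 9) asked the barrier-typer to bind "band 1" of cand-5's C5-N7 band map to the kernel: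
the reader `|ε₁^{ev}(a, N)|` at ONE window is matched EXACTLY by ONE prime dial INSIDE that window, the matched
datum being form-negative AT THE SAME WINDOW (the served-menu / same-window closure word of the two-domain
convention A41-DOM — distinct from the far-prime closure `exactMultiDialMatching_of_determinedBelow`, which leaves
the window matrix untouched). This file PROVES it with the ONLY binder `0 < ε₁(ζ; a, N)` (the regime of interest;
the served sign `S_p^{ev} < 0` that the DERIVED certificate used is NOT needed: the first basis vector `ξ₀` always
has a positive pattern value `θ₀₀(log p) = (2a − log p)/2a`).

* §1 `bottomRayleigh` TOOLKIT (PROVED): the Rayleigh set is nonempty and bounded below; `ε₁ ≤` every Rayleigh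
  value; `ε₁ < r` is witnessed; and the `τ_unif` LIPSCHITZ LAW `|ε₁(M) − ε₁(M')| ≤ δ` whenever
  `|vᵀ(M − M')v| ≤ δ vᵀv` — so the bottom-eigenvalue reader at finitely many windows is `ReaderContinuousAt` every
  datum (`readerContinuousAt_bottomRayleigh`): the `R1`-with-`a`-uniform-modulus hypothesis of
  `PfPersistenceDialMatching` is DISCHARGED for `ε₁`-readers (`not_separates_of_bottomMarginClass_subset`).
* §2 THE DIAL PATH (PROVED): `K ↦ ε₁(ζ-block dialled by K at p; a, N)` is `2 w(p)`-Lipschitz, hence continuous.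
* §3 THE IN-WINDOW MIRROR (PROVED): `InWindowDialMatchingAt win F` (TYPED: a composite of dials at primes INSIDE
  `win` reads exactly like `ζ` under `F`, differs from `ζ` AT `win`, and is form-negative AT `win`) implies
  `ExactMultiDialMatching F`; and for `F d = |ε₁(d; win)|` it HOLDS at every window containing a prime with
  `0 < ε₁(ζ; win)`, by the intermediate value theorem along the `p`-dial: `ε₁(K = 1) = ε₁ > 0`, the Rayleigh value
  of any `u` with `uᵀP_p u ≠ 0` is driven to `−ε₁` at an explicit `K_R ≠ 1`, so `ε₁(K*) = −ε₁` for some `K*`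
  strictly between (`inWindowDialMatchingAt_abs_bottomRayleigh`). Consequence: no criterion factoring through
  `|ε₁^{ev}|` at one such window separates `ζ` from the negatives of the arithmetic dial space, with a SAME-WINDOW
  witness (`not_separates_of_factorsThrough_abs_bottomRayleigh`).

Band 2 of A73 (two in-window dials matching `(|ε₁^{ev}|, ε₁^{odd})`, Newton–Kantorovich datum as binder) is NOT in
this file.
-/

set_option linter.dupNamespace false  -- the mandated namespace repeats `RiemannHypothesis`

noncomputable section

open Real Finset Matrix Set

namespace Summit.RiemannHypothesis.RiemannHypothesis.Theorems.PfPersistence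

/-! ## §1 The `bottomRayleigh` toolkit and the `τ_unif`-Lipschitz law of `ε₁` -/

/-- the RAYLEIGH SET of a window matrix: all Rayleigh quotients of nonzero vectors (`bottomRayleigh = sInf` of it). [folklore] -/
def rayleighSet {n : ℕ} (M : Matrix (Fin n) (Fin n) ℝ) : Set ℝ :=
  {r : ℝ | ∃ v : Fin n → ℝ, v ≠ 0 ∧ r = v ⬝ᵥ (M *ᵥ v) / (v ⬝ᵥ v)}

/-- PROVED: `bottomRayleigh M = sInf (rayleighSet M)` (definitional unfolding). [folklore] -/
theorem bottomRayleigh_eq_sInf {n : ℕ} (M : Matrix (Fin n) (Fin n) ℝ) : bottomRayleigh M = sInf (rayleighSet M) :=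
  rfl

/-- PROVED: a product of two coordinates is bounded by the squared norm, `|v i| |v j| ≤ v ⬝ᵥ v`. [folklore] -/
theorem abs_mul_abs_le_dotProduct_self {n : ℕ} (v : Fin n → ℝ) (i j : Fin n) : |v i| * |v j| ≤ v ⬝ᵥ v := by
  have hi : v i * v i ≤ v ⬝ᵥ v :=
    Finset.single_le_sum (f := fun k => v k * v k) (fun k _ => mul_self_nonneg (v k)) (Finset.mem_univ i)
  have hj : v j * v j ≤ v ⬝ᵥ v :=
    Finset.single_le_sum (f := fun k => v k * v k) (fun k _ => mul_self_nonneg (v k)) (Finset.mem_univ j)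
  nlinarith [abs_mul_abs_self (v i), abs_mul_abs_self (v j), abs_nonneg (v i), abs_nonneg (v j),
    sq_nonneg (|v i| - |v j|)]

/-- the ENTRYWISE SIZE `Σ_{i,j} |M_{ij}|` of a window matrix (a crude form bound). [folklore] -/
def entrySum {n : ℕ} (M : Matrix (Fin n) (Fin n) ℝ) : ℝ := ∑ i, ∑ j, |M i j|

/-- PROVED: `0 ≤ entrySum M`. [folklore] -/
theorem entrySum_nonneg {n : ℕ} (M : Matrix (Fin n) (Fin n) ℝ) : 0 ≤ entrySum M :=
  Finset.sum_nonneg fun _ _ => Finset.sum_nonneg fun _ _ => abs_nonneg _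

/-- PROVED (crude form bound): `|vᵀMv| ≤ (Σ_{i,j} |M_{ij}|) · vᵀv`. [folklore] -/
theorem abs_form_le_entrySum_mul {n : ℕ} (M : Matrix (Fin n) (Fin n) ℝ) (v : Fin n → ℝ) :
    |v ⬝ᵥ (M *ᵥ v)| ≤ entrySum M * (v ⬝ᵥ v) := by
  have hexp : v ⬝ᵥ (M *ᵥ v) = ∑ i, ∑ j, v i * M i j * v j := by
    simp only [dotProduct, Matrix.mulVec, Finset.mul_sum, mul_assoc]
  rw [hexp, entrySum, Finset.sum_mul]
  refine (Finset.abs_sum_le_sum_abs _ _).trans (Finset.sum_le_sum fun i _ => ?_)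
  rw [Finset.sum_mul]
  refine (Finset.abs_sum_le_sum_abs _ _).trans (Finset.sum_le_sum fun j _ => ?_)
  rw [abs_mul, abs_mul]
  calc |v i| * |M i j| * |v j| = |M i j| * (|v i| * |v j|) := by ring
    _ ≤ |M i j| * (v ⬝ᵥ v) := mul_le_mul_of_nonneg_left (abs_mul_abs_le_dotProduct_self v i j) (abs_nonneg _)

/-- PROVED: every Rayleigh quotient is `≥ −Σ|M_{ij}|`; the Rayleigh set is bounded below. [folklore] -/
theorem rayleighSet_bddBelow {n : ℕ} (M : Matrix (Fin n) (Fin n) ℝ) : BddBelow (rayleighSet M) := by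
  refine ⟨-entrySum M, ?_⟩
  rintro r ⟨v, hv, rfl⟩
  have hvv : 0 < v ⬝ᵥ v := lt_of_le_of_ne (dotProduct_self_nonneg_real v) fun h => hv (dotProduct_self_eq_zero.1 h.symm)
  rw [le_div_iff₀ hvv]
  have := abs_form_le_entrySum_mul M v
  have := neg_abs_le (v ⬝ᵥ (M *ᵥ v))
  linarith

/-- PROVED: in positive dimension the Rayleigh set is nonempty (the constant vector `1`). [folklore] -/
theorem rayleighSet_nonempty {n : ℕ} (M : Matrix (Fin (n + 1)) (Fin (n + 1)) ℝ) : (rayleighSet M).Nonempty :=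
  ⟨_, fun _ => 1, fun h => one_ne_zero (congr_fun h 0), rfl⟩

/-- PROVED: `ε₁ ≤` the Rayleigh quotient of every nonzero vector. [folklore] -/
theorem bottomRayleigh_le_rayleigh {n : ℕ} (M : Matrix (Fin n) (Fin n) ℝ) {v : Fin n → ℝ} (hv : v ≠ 0) :
    bottomRayleigh M ≤ v ⬝ᵥ (M *ᵥ v) / (v ⬝ᵥ v) :=
  csInf_le (rayleighSet_bddBelow M) ⟨v, hv, rfl⟩

/-- PROVED (homogeneous form): `ε₁ · vᵀv ≤ vᵀMv` for every vector. [folklore] -/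
theorem bottomRayleigh_mul_le_form {n : ℕ} (M : Matrix (Fin n) (Fin n) ℝ) (v : Fin n → ℝ) :
    bottomRayleigh M * (v ⬝ᵥ v) ≤ v ⬝ᵥ (M *ᵥ v) := by
  by_cases hv : v = 0
  · subst hv; simp
  have hvv : 0 < v ⬝ᵥ v := lt_of_le_of_ne (dotProduct_self_nonneg_real v) fun h => hv (dotProduct_self_eq_zero.1 h.symm)
  exact (le_div_iff₀ hvv).1 (bottomRayleigh_le_rayleigh M hv)

/-- PROVED: `ε₁ < r` is WITNESSED by a nonzero vector with Rayleigh quotient `< r` (positive dimension). [folklore] -/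
theorem exists_rayleigh_lt_of_bottomRayleigh_lt {n : ℕ} (M : Matrix (Fin (n + 1)) (Fin (n + 1)) ℝ) {r : ℝ}
    (h : bottomRayleigh M < r) : ∃ v : Fin (n + 1) → ℝ, v ≠ 0 ∧ v ⬝ᵥ (M *ᵥ v) / (v ⬝ᵥ v) < r := by
  obtain ⟨s, ⟨v, hv, rfl⟩, hs⟩ := (csInf_lt_iff (rayleighSet_bddBelow M) (rayleighSet_nonempty M)).1 h
  exact ⟨v, hv, hs⟩

/-- PROVED: a negative bottom, `ε₁ < 0`, is witnessed by a form-negative vector (so the datum is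
`DetectablyNegative` at that window). [folklore] -/
theorem exists_form_neg_of_bottomRayleigh_neg {n : ℕ} (M : Matrix (Fin (n + 1)) (Fin (n + 1)) ℝ)
    (h : bottomRayleigh M < 0) : ∃ v : Fin (n + 1) → ℝ, v ⬝ᵥ (M *ᵥ v) < 0 := by
  obtain ⟨v, hv, hlt⟩ := exists_rayleigh_lt_of_bottomRayleigh_lt M h
  exact ⟨v, (div_neg_iff.1 hlt).resolve_left (fun h' => (not_lt.2 (dotProduct_self_nonneg_real v)) h'.2) |>.1⟩

/-- PROVED: a bound `b ≤` every Rayleigh quotient is a bound `b ≤ ε₁` (positive dimension). [folklore] -/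
theorem le_bottomRayleigh_of_forall {n : ℕ} (M : Matrix (Fin (n + 1)) (Fin (n + 1)) ℝ) {b : ℝ}
    (h : ∀ v : Fin (n + 1) → ℝ, v ≠ 0 → b ≤ v ⬝ᵥ (M *ᵥ v) / (v ⬝ᵥ v)) : b ≤ bottomRayleigh M :=
  le_csInf (rayleighSet_nonempty M) (by rintro r ⟨v, hv, rfl⟩; exact h v hv)

/-- **PROVED — THE `τ_unif`-LIPSCHITZ LAW OF `ε₁`.** If two window matrices are form-close,
`|vᵀ(M − M')v| ≤ δ · vᵀv` for all `v`, then `|ε₁(M) − ε₁(M')| ≤ δ`. (No symmetry, no eigen-decomposition.) [folklore] -/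
theorem abs_bottomRayleigh_sub_le {n : ℕ} {M M' : Matrix (Fin (n + 1)) (Fin (n + 1)) ℝ} {δ : ℝ}
    (h : ∀ v : Fin (n + 1) → ℝ, |v ⬝ᵥ ((M - M') *ᵥ v)| ≤ δ * (v ⬝ᵥ v)) :
    |bottomRayleigh M - bottomRayleigh M'| ≤ δ := by
  have key : ∀ (A B : Matrix (Fin (n + 1)) (Fin (n + 1)) ℝ),
      (∀ v : Fin (n + 1) → ℝ, |v ⬝ᵥ ((A - B) *ᵥ v)| ≤ δ * (v ⬝ᵥ v)) →
        bottomRayleigh B - δ ≤ bottomRayleigh A := by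
    intro A B hAB
    refine le_bottomRayleigh_of_forall A fun v hv => ?_
    have hvv : 0 < v ⬝ᵥ v := dotProduct_self_pos_of_ne_zero hv
    have h1 := bottomRayleigh_le_rayleigh B hv
    have h2 := hAB v
    rw [Matrix.sub_mulVec, dotProduct_sub] at h2
    have h3 := (abs_le.1 h2).1
    rw [le_div_iff₀ hvv, sub_mul]
    rw [le_div_iff₀ hvv] at h1
    linarith
  have hMM' := key M M' h
  have hM'M : bottomRayleigh M - δ ≤ bottomRayleigh M' := key M' M fun v => by
    rw [← neg_sub M M', Matrix.neg_mulVec, dotProduct_neg, abs_neg]; exact h v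
  rw [abs_le]; constructor <;> linarith

/-- **PROVED — `ε₁` is `1`-LIPSCHITZ IN `τ_unif` on data:** `UniformlyClose ε d d' ⇒ |ε₁(d; w) − ε₁(d'; w)| ≤ ε`
at EVERY window `w`, uniformly. [folklore] -/
theorem abs_bottomRayleigh_sub_le_of_uniformlyClose {ε : ℝ} {d d' : Datum} (h : UniformlyClose ε d d')
    (win : Window) : |bottomRayleigh (d win) - bottomRayleigh (d' win)| ≤ ε :=
  abs_bottomRayleigh_sub_le (h win)

/-- **PROVED — the `R1`-continuity hypothesis DISCHARGED for bottom-eigenvalue readers:** the reader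
`d ↦ (ε₁(d; W i))_{i < k}` of the bottoms at finitely many windows is `ReaderContinuousAt` every datum (in fact
`1`-Lipschitz in `τ_unif`; the window-uniform modulus that `PfPersistenceDialMatching` had to ASSUME). [folklore] -/
theorem readerContinuousAt_bottomRayleigh {k : ℕ} (W : Fin k → Window) (d₀ : Datum) :
    ReaderContinuousAt (fun d i => bottomRayleigh (d (W i))) d₀ := by
  intro η hη
  refine ⟨η / 2, half_pos hη, fun d hd i => ?_⟩
  have := abs_bottomRayleigh_sub_le_of_uniformlyClose hd (W i)
  rw [abs_sub_comm] at this
  exact lt_of_le_of_lt this (half_lt_self hη)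

/-- **PROVED (wall W2 for `ε₁`-margin readers, continuity discharged):** a class containing a margin class of the
bottom-eigenvalue reader at finitely many windows cannot separate `ζ` from the detectably negative data of any
domain `⊇ arithDialSpace` — modulo `DialReady p β₀` at one weighted prime power ONLY. [folklore] -/
theorem not_separates_of_bottomMarginClass_subset {k : ℕ} (W : Fin k → Window) {η : ℝ} (hη : 0 < η)
    {S D : Set Datum} (hS : marginClass (fun d i => bottomRayleigh (d (W i))) η ⊆ S) (hD : arithDialSpace ⊆ D)
    {p : ℕ} {β₀ : ℝ} (hβ₀ : 0 < β₀) (hw : 0 < zetaWeights p) (hready : DialReady p β₀) :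
    ¬ Separates S D zetaDatum :=
  not_separates_of_marginClass_subset_arith (readerContinuousAt_bottomRayleigh W zetaDatum) hη hS hD hβ₀ hw hready

/-! ## §2 The dial path `K ↦ ε₁(dial p K; win)` is Lipschitz -/

/-- PROVED: the trivial dial `K = 1` is the identity on weight tables. [folklore] -/
@[simp] theorem dial_one (p : ℕ) (w : Weights) : dial p 1 w = w := by
  funext q; simp [dial]

/-- the bottom of `ζ`'s even block DIALLED BY `K` AT `p`, read at the window `win` (schema: `eps1_even` of the
`λ`-pert / two-sided `p`-dial record). [folklore] -/
def dialBottom (p : ℕ) (win : Window) (K : ℝ) : ℝ := bottomRayleigh (evenBlock (dial p K zetaWeights) win)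

/-- PROVED: at `K = 1` the dialled bottom is `ζ`'s bottom `ε₁(ζ; win)`. [folklore] -/
@[simp] theorem dialBottom_one (p : ℕ) (win : Window) : dialBottom p win 1 = bottomRayleigh (zetaDatum win) := by
  simp [dialBottom, zetaDatum, datumOf]

/-- PROVED: two dials at the same in-range `p` differ by a multiple of the prime pattern,
`Q(K) − Q(K') = (2 (K' − K) w(p)) • P_p`. [folklore] -/
theorem evenBlock_dial_sub_dial {p : ℕ} {win : Window} (hp : p ∈ primeRange (2 * win.a)) (K K' : ℝ) (w : Weights) :
    evenBlock (dial p K w) win - evenBlock (dial p K' w) win = (2 * (K' - K) * w p) • primePattern p win := by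
  rw [evenBlock_dial_eq hp, evenBlock_dial_eq hp]
  ext i j
  simp only [Matrix.sub_apply, Matrix.smul_apply, smul_eq_mul]
  ring

/-- **PROVED — the dial path is `2|w(p)|`-LIPSCHITZ:** `|ε₁(K) − ε₁(K')| ≤ 2 |w(p)| |K − K'|`. [folklore] -/
theorem abs_dialBottom_sub_le (p : ℕ) (win : Window) (K K' : ℝ) :
    |dialBottom p win K - dialBottom p win K'| ≤ 2 * |zetaWeights p| * |K - K'| := by
  unfold dialBottom
  by_cases hp : p ∈ primeRange (2 * win.a)
  · refine abs_bottomRayleigh_sub_le fun v => ?_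
    rw [evenBlock_dial_sub_dial hp, Matrix.smul_mulVec, dotProduct_smul, smul_eq_mul, abs_mul]
    have h1 := primePattern_form_abs_le win.ha hp v
    have h2 : |2 * (K' - K) * zetaWeights p| = 2 * |zetaWeights p| * |K - K'| := by
      rw [abs_mul, abs_mul, abs_two, abs_sub_comm]; ring
    rw [h2]
    exact mul_le_mul_of_nonneg_left h1 (by positivity)
  · have hp' := not_mem_primeRange_iff.1 hp
    rw [evenBlock_dial_of_not_mem hp', evenBlock_dial_of_not_mem hp', sub_self, abs_zero]
    positivity

/-- **PROVED — the dial path is CONTINUOUS** (the binder "continuity of `t ↦ ε₁^{ev}(Q + tB_p)`" of RULING A73 (F),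
discharged). [folklore] -/
theorem continuous_dialBottom (p : ℕ) (win : Window) : Continuous (dialBottom p win) := by
  have hL : LipschitzWith ⟨2 * |zetaWeights p|, by positivity⟩ (dialBottom p win) := by
    refine LipschitzWith.of_dist_le_mul fun K K' => ?_
    rw [Real.dist_eq, Real.dist_eq]
    exact abs_dialBottom_sub_le p win K K'
  exact hL.continuous

/-! ## §3 The in-window one-dial mirror -/

/-- **TYPED — IN-WINDOW DIAL MATCHING AT `win` for the reader `F`:** some NONEMPTY composite of dials at PRIMES
INSIDE the window (`log p < 2a`) applied to `ζ` (i) reads exactly like `ζ` under `F`, (ii) differs from `ζ` AT the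
window `win` itself, and (iii) is form-negative AT `win`. This is the SAME-WINDOW / served-menu closure word of the
two-domain convention (A41-DOM, A73): the witness perturbs the very matrix that is read, unlike the far-prime
witnesses of `exactMultiDialMatching_of_determinedBelow`. [folklore] -/
def InWindowDialMatchingAt (win : Window) {ρ : Type} (F : Datum → ρ) : Prop :=
  ∃ L : List (ℕ × ℝ), L ≠ [] ∧ (∀ pk ∈ L, pk.1.Prime ∧ Real.log pk.1 < 2 * win.a) ∧
    F (datumOf (multiDial L zetaWeights)) = F zetaDatum ∧
    datumOf (multiDial L zetaWeights) win ≠ zetaDatum win ∧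
    ∃ v : Fin (win.N + 1) → ℝ, v ⬝ᵥ (datumOf (multiDial L zetaWeights) win *ᵥ v) < 0

/-- PROVED: in-window matching at `win` is exact multi-dial matching (forget where the witness lives). [folklore] -/
theorem InWindowDialMatchingAt.exactMultiDialMatching {win : Window} {ρ : Type} {F : Datum → ρ}
    (h : InWindowDialMatchingAt win F) : ExactMultiDialMatching F := by
  obtain ⟨L, -, hL, hF, hne, v, hv⟩ := h
  refine ⟨L, fun pk hpk => (hL pk hpk).1, fun heq => hne (by rw [heq]), hF, win, v, hv⟩

/-- PROVED: the matched in-window datum is an arithmetic dial-space member, `≠ ζ`, detectably negative. [folklore] -/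
theorem InWindowDialMatchingAt.exists_mem_arithDialSpace {win : Window} {ρ : Type} {F : Datum → ρ}
    (h : InWindowDialMatchingAt win F) :
    ∃ d ∈ arithDialSpace, d ≠ zetaDatum ∧ F d = F zetaDatum ∧ d win ≠ zetaDatum win ∧
      ∃ v : Fin (win.N + 1) → ℝ, v ⬝ᵥ (d win *ᵥ v) < 0 := by
  obtain ⟨L, -, -, hF, hne, v, hv⟩ := h
  exact ⟨_, datumOf_multiDial_zeta_mem_arithDialSpace L, fun heq => hne (by rw [heq]), hF, hne, v, hv⟩

/-- PROVED: the Rayleigh value of a fixed vector moves AFFINELY along the `p`-dial,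
`uᵀQ(K)u = uᵀQu − 2(K−1) w(p) · uᵀP_p u`. [folklore] -/
theorem form_evenBlock_dial {p : ℕ} {win : Window} (hp : p ∈ primeRange (2 * win.a)) (K : ℝ) (w : Weights)
    (u : Fin (win.N + 1) → ℝ) :
    u ⬝ᵥ (evenBlock (dial p K w) win *ᵥ u)
      = u ⬝ᵥ (evenBlock w win *ᵥ u) - 2 * (K - 1) * w p * (u ⬝ᵥ (primePattern p win *ᵥ u)) := by
  rw [evenBlock_dial_eq hp, rayleigh_sub_smul]

/-- **PROVED — THE IN-WINDOW ONE-DIAL MIRROR (general direction).** At a window `win` reaching the prime `p`, with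
`0 < ε₁ := ε₁(ζ; win)`, and ANY vector `u` whose pattern value `s := uᵀP_p u` is nonzero: the dial
`K_R := 1 + (uᵀQu + ε₁ uᵀu)/(2 w(p) s)` drives `u`'s Rayleigh quotient to `−ε₁`, so by the intermediate value
theorem along the (continuous) dial path some `K*` between `1` and `K_R`, `K* ≠ 1`, has `ε₁(K*) = −ε₁` EXACTLY:
the ONE-dial datum reads `|ε₁| = ε₁` like `ζ`, differs from `ζ` at `win`, and is form-negative at `win`. [folklore] -/
theorem exists_dial_bottom_eq_neg {win : Window} {p : ℕ} (hp : p.Prime) (hpw : p ∈ primeRange (2 * win.a))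
    (hpos : 0 < bottomRayleigh (zetaDatum win)) {u : Fin (win.N + 1) → ℝ}
    (hs : u ⬝ᵥ (primePattern p win *ᵥ u) ≠ 0) :
    ∃ K : ℝ, K ≠ 1 ∧ dialBottom p win K = -bottomRayleigh (zetaDatum win) := by
  set ε₁ := bottomRayleigh (zetaDatum win) with hε₁
  set s := u ⬝ᵥ (primePattern p win *ᵥ u) with hsdef
  have hwp : 0 < zetaWeights p := zetaWeights_pos_of_prime hp
  have hu : u ≠ 0 := by rintro rfl; simp [hsdef] at hs
  have huu : 0 < u ⬝ᵥ u := dotProduct_self_pos_of_ne_zero hu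
  -- the Rayleigh numerator of `u` at `ζ` is at least `ε₁ uᵀu > 0`
  have hQu : ε₁ * (u ⬝ᵥ u) ≤ u ⬝ᵥ (zetaDatum win *ᵥ u) := bottomRayleigh_mul_le_form _ u
  set K_R : ℝ := 1 + (u ⬝ᵥ (zetaDatum win *ᵥ u) + ε₁ * (u ⬝ᵥ u)) / (2 * zetaWeights p * s) with hKR
  have hden : 2 * zetaWeights p * s ≠ 0 := mul_ne_zero (by positivity) hs
  have hKR1 : K_R ≠ 1 := by
    intro h
    have : (u ⬝ᵥ (zetaDatum win *ᵥ u) + ε₁ * (u ⬝ᵥ u)) / (2 * zetaWeights p * s) = 0 := by linarith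
    rcases div_eq_zero_iff.1 this with h0 | h0
    · nlinarith [mul_pos hpos huu]
    · exact hden h0
  -- at `K_R` the Rayleigh quotient of `u` equals `−ε₁`
  have hform : u ⬝ᵥ (evenBlock (dial p K_R zetaWeights) win *ᵥ u) = -ε₁ * (u ⬝ᵥ u) := by
    rw [form_evenBlock_dial hpw]
    have : 2 * (K_R - 1) * zetaWeights p * s = u ⬝ᵥ (zetaDatum win *ᵥ u) + ε₁ * (u ⬝ᵥ u) := by
      rw [hKR]; field_simp; ring
    change u ⬝ᵥ (zetaDatum win *ᵥ u) - 2 * (K_R - 1) * zetaWeights p * s = -ε₁ * (u ⬝ᵥ u)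
    linarith
  have hKRle : dialBottom p win K_R ≤ -ε₁ := by
    have := bottomRayleigh_le_rayleigh (evenBlock (dial p K_R zetaWeights) win) hu
    rwa [hform, mul_div_assoc, div_self huu.ne', mul_one] at this
  -- IVT between `1` and `K_R`
  have h1 : dialBottom p win 1 = ε₁ := dialBottom_one p win
  have hcont := continuous_dialBottom p win
  have htarget : -ε₁ ∈ Icc (dialBottom p win K_R) (dialBottom p win 1) := ⟨hKRle, by rw [h1]; linarith⟩
  rcases le_total 1 K_R with hle | hle
  · obtain ⟨K, -, hK⟩ := intermediate_value_Icc' hle hcont.continuousOn htarget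
    refine ⟨K, fun hK1 => ?_, hK⟩
    rw [hK1, h1] at hK; linarith
  · obtain ⟨K, -, hK⟩ := intermediate_value_Icc hle hcont.continuousOn htarget
    refine ⟨K, fun hK1 => ?_, hK⟩
    rw [hK1, h1] at hK; linarith

/-- PROVED: the first basis vector has the POSITIVE pattern value `θ₀₀(log p) = (2a − log p)/(2a)` at every window
strictly containing `p` — a direction with `uᵀP_p u ≠ 0` always exists; no served sign is needed. [folklore] -/
theorem primePattern_single_zero_pos {win : Window} {p : ℕ} (hpa : Real.log p < 2 * win.a) :
    0 < (Pi.single 0 1 : Fin (win.N + 1) → ℝ) ⬝ᵥ (primePattern p win *ᵥ Pi.single 0 1) := by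
  rw [single_zero_rayleigh]
  simp only [primePattern, Fin.val_zero, thetaEven_zero_zero]
  have ha := win.ha
  exact div_pos (by linarith) (by linarith)

/-- **PROVED — BAND 1 OF RULING A73 AS A THEOREM: the reader `|ε₁^{ev}|` at one window is mirrored by ONE
in-window prime dial.** For every window `win`, every prime `p` strictly inside it (`log p < 2a`) and
`0 < ε₁(ζ; win)` (the ONLY binder — the served sign of the regime of interest):
`InWindowDialMatchingAt win (d ↦ |ε₁(d; win)|)`, witnessed by a single dial `(p, K*)`, `K* ≠ 1`, with
`ε₁(K*) = −ε₁(ζ)` exactly. [folklore] -/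
theorem inWindowDialMatchingAt_abs_bottomRayleigh (win : Window) {p : ℕ} (hp : p.Prime)
    (hpa : Real.log p < 2 * win.a) (hpos : 0 < bottomRayleigh (zetaDatum win)) :
    InWindowDialMatchingAt win (fun d : Datum => |bottomRayleigh (d win)|) := by
  have hpw : p ∈ primeRange (2 * win.a) := mem_primeRange_of_log_le hpa.le
  obtain ⟨K, hK1, hK⟩ := exists_dial_bottom_eq_neg hp hpw hpos (primePattern_single_zero_pos hpa).ne'
  have hwp : 0 < zetaWeights p := zetaWeights_pos_of_prime hp
  refine ⟨[(p, K)], List.cons_ne_nil _ _, fun pk hpk => ?_, ?_, ?_, ?_⟩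
  · simp only [List.mem_singleton] at hpk; subst hpk; exact ⟨hp, hpa⟩
  · show |bottomRayleigh (evenBlock (dial p K zetaWeights) win)| = |bottomRayleigh (zetaDatum win)|
    change |dialBottom p win K| = _
    rw [hK, abs_neg]
  · show evenBlock (dial p K zetaWeights) win ≠ zetaDatum win
    intro heq
    have h00 := congr_fun (congr_fun heq 0) 0
    rw [evenBlock_dial_zero_zero hpw] at h00
    change evenBlock zetaWeights win 0 0 - _ = evenBlock zetaWeights win 0 0 at h00
    have ha := win.ha
    have hθ : 0 < (2 * win.a - Real.log p) / (2 * win.a) := div_pos (by linarith) (by linarith)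
    have : 2 * (K - 1) * zetaWeights p * ((2 * win.a - Real.log p) / (2 * win.a)) = 0 := by linarith
    rcases mul_eq_zero.1 this with h | h
    · rcases mul_eq_zero.1 h with h' | h'
      · have : K - 1 = 0 := by
          rcases mul_eq_zero.1 h' with h'' | h''
          · norm_num at h''
          · exact h''
        exact hK1 (by linarith)
      · exact hwp.ne' h'
    · exact hθ.ne' h
  · show ∃ v : Fin (win.N + 1) → ℝ, v ⬝ᵥ (evenBlock (dial p K zetaWeights) win *ᵥ v) < 0
    apply exists_form_neg_of_bottomRayleigh_neg
    change dialBottom p win K < 0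
    rw [hK]; linarith

/-- PROVED (corollary): `ExactMultiDialMatching` of `|ε₁^{ev}|` at one window by an IN-WINDOW dial (band 1;
the far-prime version is `exactMultiDialMatching_of_determinedBelow`). [folklore] -/
theorem exactMultiDialMatching_abs_bottomRayleigh_inWindow (win : Window) {p : ℕ} (hp : p.Prime)
    (hpa : Real.log p < 2 * win.a) (hpos : 0 < bottomRayleigh (zetaDatum win)) :
    ExactMultiDialMatching (fun d : Datum => |bottomRayleigh (d win)|) :=
  (inWindowDialMatchingAt_abs_bottomRayleigh win hp hpa hpos).exactMultiDialMatching

/-- **PROVED — SAME-WINDOW NON-SEPARATION for `|ε₁^{ev}|`-readers (A73 band 1, closure word of record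
`closed-global (thm | served sign ε₁(ζ; a, N) > 0)`):** a criterion factoring through `|ε₁^{ev}(a, N)|` at a window
containing a prime cannot separate `ζ` from the detectably negative members of any domain `⊇ arithDialSpace`; the
witness is ONE in-window dial, negative AT `(a, N)`. [folklore] -/
theorem not_separates_of_factorsThrough_abs_bottomRayleigh {S D : Set Datum} (win : Window)
    (hS : FactorsThrough S (fun d : Datum => |bottomRayleigh (d win)|)) (hD : arithDialSpace ⊆ D)
    {p : ℕ} (hp : p.Prime) (hpa : Real.log p < 2 * win.a) (hpos : 0 < bottomRayleigh (zetaDatum win)) :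
    ¬ Separates S D zetaDatum :=
  hS.not_separates_arith (exactMultiDialMatching_abs_bottomRayleigh_inWindow win hp hpa hpos) hD

/-- PROVED (the `p = 2` instance): at every window with `log 2 < 2a` (schema: `a > 0.3466`, every served window
with a prime inside) and `ε₁(ζ; a, N) > 0`, the `|ε₁^{ev}|`-reader is mirrored by one in-window `2`-dial. [folklore] -/
theorem inWindowDialMatchingAt_abs_bottomRayleigh_two (win : Window) (ha : Real.log 2 < 2 * win.a)
    (hpos : 0 < bottomRayleigh (zetaDatum win)) :
    InWindowDialMatchingAt win (fun d : Datum => |bottomRayleigh (d win)|) :=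
  inWindowDialMatchingAt_abs_bottomRayleigh win Nat.prime_two (by exact_mod_cast ha) hpos

end Summit.RiemannHypothesis.RiemannHypothesis.Theorems.PfPersistence

end
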